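import Literature.AlgebraicGeometry.Resolution.ArithmeticalThreefoldsBlowupForm
import Literature.AlgebraicGeometry.Resolution.ProjectiveBirationalBlowupAffine
import Literature.AlgebraicGeometry.Resolution.QuasiExcellentSchemes
import Literature.AlgebraicGeometry.Resolution.ExcellentRingsFieldProofs
import HarnessLib

/-!
# Cossart–Piltant's affine threefold resolution as one blowing up — reduction to the projective form of Thm. 1.1

Topic: `Literature/AlgebraicGeometry/Resolution`. Theorem-only file (sorry-free, no named facts),
companion of the named fact `CossartPiltant2019AffineOneBlowup`
(`ArithmeticalThreefoldsBlowupForm.lean`): for an integral affine `Spec A` of finite type over a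
field with `dim A ≤ 3`, a non-zero ideal `J` with `Bl_J(Spec A)` regular and `Bl_J → Spec A` an
isomorphism over `Reg (Spec A)`. That fact is, as its docstring says, the COROLLARY of two
printed theorems:

1. Cossart–Piltant 2019, Thm. 1.1 (i)(ii) together with its projectivity complement ("If
   furthermore a finite affine covering `𝒳 = 𝒰₁ ∪ ⋯ ∪ 𝒰ₙ` is specified, one may take
   `π⁻¹(𝒰ᵢ) → 𝒰ᵢ` projective", arXiv:1412.0868v1 p. 3; for affine `𝒳 = Spec A` with the
   one-piece covering: `π` projective — which is also how the theorem is proved, Prop. 4.4,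
   Steps 3–4, p. 51), and
2. Liu 2002, Thm. 8.1.24 (a projective birational morphism onto [a scheme quasi-projective over]
   an affine Noetherian scheme is a blowing up).

Item 2 over an affine base is PROVED in the tree (`ProjectiveBirationalBlowupAffine.lean`,
`exists_iso_affineBlowup_of_isProjOver_of_isBirational`). Item 1 is the 270-page theorem itself;
the tree's named fact `CossartPiltant2019General` (`QuasiExcellentSchemes.lean`) vendors Thm. 1.1
WITHOUT the projectivity complement (its faithfulness notes say so), and a proper, non-projective
resolution cannot be fed into Liu 8.1.24. This file therefore proves the fact MODULO item 1 in its
affine form, taken as an explicit hypothesis spelled exactly as the printed statement (in the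
vocabulary of `CossartPiltant2019General` plus `ChowLemmaRing.IsProjOver` = Liu Def. 3.1.11):

* `regularLocus_Spec_eq` — `Reg (Spec A) = {𝔭 | A_𝔭 regular}` (`𝒪_{Spec A,𝔭} ≅ A_𝔭`);
* `exists_affineBlowup_of_projective_resolution` — **a projective resolution `π : X' → Spec A`
  (`A` a domain) which is an isomorphism over `U` yields a non-zero `J` with `Bl_J(Spec A)`
  regular and `Bl_J → Spec A` an isomorphism over `U`** (Liu 8.1.24 over an affine base:
  `X' ≅ Bl_J(Spec A)` over `Spec A`);
* `CossartPiltant2019AffineOneBlowup.of_projective_resolution` — **the named fact from the affine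
  projective form of CP 2019 Thm. 1.1 (i)(ii)** (finite type algebras over a field are
  quasi-excellent by the tree's `Stacks07QW_field_holds`).

So the remaining debt of `CossartPiltant2019AffineOneBlowup` is exactly the projectivity clause
of Cossart–Piltant's Thm. 1.1 for affine schemes.

## References

* V. Cossart, O. Piltant, *Resolution of singularities of arithmetical threefolds*, J. Algebra 529
  (2019) 268–535 = arXiv:1412.0868: Thm. 1.1 and the sentence following (iii) (v1 p. 3);
  Prop. 4.4, proof, Steps 2–4 (v1 pp. 50–52). [CossartPiltant2019]
* Q. Liu, *Algebraic Geometry and Arithmetic Curves*, OUP 2002: Thm. 8.1.24 (PDF p. 388),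
  Def. 3.1.11 (PDF p. 112). [Liu2002]
* The Stacks Project, Tag 07QW. [StacksProject]
-/

noncomputable section

open CategoryTheory AlgebraicGeometry

namespace Literature.AlgebraicGeometry.Resolution

universe u

/-- The regular locus of `Spec A` consists of the primes `𝔭` with `A_𝔭` regular
(`𝒪_{Spec A, 𝔭} ≅ A_𝔭`, Mathlib `StructureSheaf.IsLocalization.to_stalk`). [folklore] -/
theorem regularLocus_Spec_eq (A : Type u) [CommRing A] :
    Scheme.regularLocus (Spec (.of A)) =
      {x | IsRegularLocalRing (Localization.AtPrime x.asIdeal)} := by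
  ext x
  letI : Algebra A ((Spec (.of A)).presheaf.stalk x) := (StructureSheaf.toStalk A x).hom.toAlgebra
  have hloc : IsLocalization.AtPrime ((Spec (.of A)).presheaf.stalk x) x.asIdeal :=
    StructureSheaf.IsLocalization.to_stalk A x
  let e := (IsLocalization.algEquiv x.asIdeal.primeCompl ((Spec (.of A)).presheaf.stalk x)
    (Localization.AtPrime x.asIdeal)).toRingEquiv
  rw [Scheme.mem_regularLocus, Set.mem_setOf_eq]
  exact ⟨fun h => IsRegularLocalRing.of_ringEquiv e, fun h => IsRegularLocalRing.of_ringEquiv e.symm⟩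

/-- **From a projective resolution to the blow-up form.** If `π : X' → Spec A` (`A` a domain) is
a resolution of singularities (`IsResolution`: proper, birational, `X'` regular) which is
projective over `Spec A` (`ChowLemmaRing.IsProjOver`: a closed `A`-immersion into some `ℙⁿ_A`)
and an isomorphism over an open `U ⊆ Spec A`, then there is a non-zero ideal `J ⊆ A` with
`Bl_J(Spec A)` regular and `Bl_J(Spec A) → Spec A` an isomorphism over `U`. Indeed `X'` is
integral (regular, hence reduced, and birational over the integral `Spec A`), so by Liu 2002,
Thm. 8.1.24 over an affine base (`exists_iso_affineBlowup_of_isProjOver_of_isBirational`)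
`X' ≅ Bl_J(Spec A)` over `Spec A` for some `J ≠ 0`. [cite: Liu2002, Thm. 8.1.24] -/
theorem exists_affineBlowup_of_projective_resolution {A : Type u} [CommRing A] [IsDomain A]
    {X' : Scheme.{u}} (π : X' ⟶ Spec (.of A)) (hπ : IsResolution π)
    (hproj : ChowLemmaRing.IsProjOver (Over.mk π)) (U : (Spec (.of A)).Opens) [IsIso (π ∣_ U)] :
    ∃ J : Ideal A, J ≠ ⊥ ∧ Scheme.IsRegular (affineBlowup J) ∧ IsIso (affineBlowup.π J ∣_ U) := by
  haveI : IsReduced X' := hπ.isRegular.isReduced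
  haveI : IsIntegral X' := hπ.isBirational.isIntegral
  obtain ⟨J, hJ, -, e, he⟩ :=
    exists_iso_affineBlowup_of_isProjOver_of_isBirational π hproj hπ.isBirational
  refine ⟨J, hJ, hπ.isRegular.of_iso e.hom, ?_⟩
  have h : affineBlowup.π J = e.inv ≫ π := by rw [← he, Iso.inv_hom_id_assoc]
  rw [h, morphismRestrict_comp]
  show IsIso (e.inv ∣_ (π ⁻¹ᵁ U) ≫ π ∣_ U)
  infer_instance

/-! ## The fact is equivalent to the affine projective form of CP Thm. 1.1 (i)(ii) for varieties -/

section Projective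

attribute [local instance] MvPolynomial.gradedAlgebra

/-- Blowing ups of finitely generated ideals are projective over the base: for generators
`b₀, …, bₙ` of `J`, `Bl_J(Spec A) = Proj A[Jt] ↪ ℙⁿ_A = Proj A[T₀, …, Tₙ]`, `T_l ↦ b_l t`, is a
closed immersion over `Spec A` (`reesPresentation`, Mathlib `Proj.map`; Liu 2002,
Prop. 8.1.12 (b) / Stacks 02NS: blowing up an ideal of finite type is projective).
[cite: Liu2002, Prop. 8.1.12 (b)] -/
theorem affineBlowup.isProjOver_span {A : Type u} [CommRing A] {n : ℕ} (b : Fin (n + 1) → A) :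
    ChowLemmaRing.IsProjOver (Over.mk (affineBlowup.π (Ideal.span (Set.range b)))) := by
  refine ⟨n, Over.homMk (Proj.map (reesPresentation b) (irrelevant_le_map_reesPresentation b))
    (BirationalBlowup.projMap_reesPresentation_comp_projToSpec b), ?_⟩
  change IsClosedImmersion (Proj.map (reesPresentation b) (irrelevant_le_map_reesPresentation b))
  exact FundamentalGroup.isClosedImmersion_projMap_of_surjective _ _ (reesPresentation_surjective b)

/-- Every blowing up of a Noetherian affine scheme along a non-zero ideal is projective over it
(choose finitely many generators). [cite: Liu2002, Prop. 8.1.12 (b)] -/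
theorem affineBlowup.isProjOver {A : Type u} [CommRing A] [IsNoetherianRing A] {J : Ideal A}
    (hJ : J ≠ ⊥) : ChowLemmaRing.IsProjOver (Over.mk (affineBlowup.π J)) := by
  obtain ⟨m, b, hb⟩ := Submodule.fg_iff_exists_fin_generating_family.mp (IsNoetherian.noetherian J)
  obtain ⟨n, rfl⟩ : ∃ n, m = n + 1 := Nat.exists_eq_succ_of_ne_zero (by
    rintro rfl
    apply hJ
    rw [← hb, Set.range_eq_empty, Submodule.span_empty])
  subst hb
  exact affineBlowup.isProjOver_span b

end Projective

/-- **The converse reduction**: under `CossartPiltant2019AffineOneBlowup`, every integral affine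
`Spec A` of finite type over a field with `dim A ≤ 3` has a PROJECTIVE resolution which is an
isomorphism over `Reg (Spec A)` — namely the blowing up `Bl_J(Spec A) → Spec A`
(`affineBlowup.isResolution`, `affineBlowup.isProjOver`). So the named fact is EQUIVALENT to the
affine projective form of Cossart–Piltant's Thm. 1.1 (i)(ii) for such `A`
(`CossartPiltant2019AffineOneBlowup_iff`). [cite: CossartPiltant2019, Thm. 1.1 (i)(ii)] -/
theorem CossartPiltant2019AffineOneBlowup.exists_projective_resolution
    (h : CossartPiltant2019AffineOneBlowup.{u}) (K : Type u) [Field K] (A : Type u) [CommRing A]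
    [IsDomain A] [Algebra K A] [Algebra.FiniteType K A] (hdim : ringKrullDim A ≤ 3) :
    ∃ (X' : Scheme.{u}) (π : X' ⟶ Spec (.of A)), IsResolution π ∧
      ChowLemmaRing.IsProjOver (Over.mk π) ∧
        ∃ U : (Spec (.of A)).Opens,
          (U : Set (Spec (.of A))) = Scheme.regularLocus (Spec (.of A)) ∧ IsIso (π ∣_ U) := by
  haveI : IsNoetherianRing A := Algebra.FiniteType.isNoetherianRing K A
  obtain ⟨J, hJ, hreg, U, hU, hiso⟩ := h K A hdim
  exact ⟨_, affineBlowup.π J, affineBlowup.isResolution hJ hreg, affineBlowup.isProjOver hJ, U,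
    hU.trans (regularLocus_Spec_eq A).symm, hiso⟩

/-- **`CossartPiltant2019AffineOneBlowup` from projective resolutions of affine varieties of
dimension `≤ 3`.** If every integral affine `Spec A` of finite type over a field with `dim A ≤ 3`
has a projective resolution (`IsResolution` + `ChowLemmaRing.IsProjOver`) which is an isomorphism
over an open `U` with `U = Reg (Spec A)`, then the named fact holds: by Liu 2002, Thm. 8.1.24
over an affine base the resolution is a blowing up `Bl_J(Spec A)`
(`exists_affineBlowup_of_projective_resolution`), and `Reg (Spec A) = {𝔭 | A_𝔭 regular}`
(`regularLocus_Spec_eq`). [cite: Liu2002, Thm. 8.1.24] -/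
theorem CossartPiltant2019AffineOneBlowup.of_forall_finiteType
    (H : ∀ (K : Type u) [Field K] (A : Type u) [CommRing A] [IsDomain A] [Algebra K A]
      [Algebra.FiniteType K A], ringKrullDim A ≤ 3 →
        ∃ (X' : Scheme.{u}) (π : X' ⟶ Spec (.of A)), IsResolution π ∧
          ChowLemmaRing.IsProjOver (Over.mk π) ∧
            ∃ U : (Spec (.of A)).Opens,
              (U : Set (Spec (.of A))) = Scheme.regularLocus (Spec (.of A)) ∧ IsIso (π ∣_ U)) :
    CossartPiltant2019AffineOneBlowup.{u} := by
  intro K _ A _ _ _ _ hdim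
  obtain ⟨X', π, hπ, hproj, U, hU, hiso⟩ := H K A hdim
  haveI := hiso
  obtain ⟨J, hJ, hreg, hisoJ⟩ := exists_affineBlowup_of_projective_resolution π hπ hproj U
  exact ⟨J, hJ, hreg, U, hU.trans (regularLocus_Spec_eq A), hisoJ⟩

/-- **`CossartPiltant2019AffineOneBlowup` is equivalent to the affine projective form of
Cossart–Piltant 2019, Thm. 1.1 (i)(ii), for integral affine schemes of finite type over a field of
dimension `≤ 3`** (a projective resolution which is an isomorphism over the regular locus).
[cite: CossartPiltant2019, Thm. 1.1 (i)(ii) and the sentence following (iii)]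
[cite: Liu2002, Thm. 8.1.24] -/
theorem CossartPiltant2019AffineOneBlowup_iff :
    CossartPiltant2019AffineOneBlowup.{u} ↔
      ∀ (K : Type u) [Field K] (A : Type u) [CommRing A] [IsDomain A] [Algebra K A]
        [Algebra.FiniteType K A], ringKrullDim A ≤ 3 →
          ∃ (X' : Scheme.{u}) (π : X' ⟶ Spec (.of A)), IsResolution π ∧
            ChowLemmaRing.IsProjOver (Over.mk π) ∧
              ∃ U : (Spec (.of A)).Opens,
                (U : Set (Spec (.of A))) = Scheme.regularLocus (Spec (.of A)) ∧ IsIso (π ∣_ U) :=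
  ⟨fun h K _ A _ _ _ _ hdim => h.exists_projective_resolution K A hdim,
    CossartPiltant2019AffineOneBlowup.of_forall_finiteType⟩

/-- **`CossartPiltant2019AffineOneBlowup` from Cossart–Piltant's Thm. 1.1 (i)(ii) WITH its
projectivity complement for affine schemes.** The hypothesis `H` is the printed theorem for
`𝒳 = Spec R` affine ("Let `𝒳` be a reduced and separated Noetherian scheme which is
quasi-excellent and of dimension at most three. There exists a proper birational morphism
`π : 𝒳' → 𝒳` with … (i) `𝒳'` is everywhere regular; (ii) `π` induces an isomorphism
`π⁻¹(Reg 𝒳) ≃ Reg 𝒳` … If furthermore a finite affine covering `𝒳 = 𝒰₁ ∪ ⋯ ∪ 𝒰ₙ` is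
specified, one may take `π⁻¹(𝒰ᵢ) → 𝒰ᵢ` projective", arXiv:1412.0868v1 p. 3, with the one-piece
covering `{𝒳}`; proved ibid. Prop. 4.4, Steps 3–4, p. 51), stated with the tree's
`IsResolution`, `Scheme.IsQuasiExcellent`, `Scheme.regularLocus` (as in
`CossartPiltant2019General`, which omits exactly the projectivity clause and therefore does not
suffice here) and `ChowLemmaRing.IsProjOver` (= Liu 2002, Def. 3.1.11: a closed immersion into
`ℙⁿ_R` over `Spec R`). An integral affine `Spec A` of finite type over a field is Noetherian,
reduced and quasi-excellent (`Stacks07QW_field_holds`), so `of_forall_finiteType` applies.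
[cite: CossartPiltant2019, Thm. 1.1 (i)(ii) and the sentence following (iii); Prop. 4.4 Steps 3–4]
[cite: Liu2002, Thm. 8.1.24] -/
theorem CossartPiltant2019AffineOneBlowup.of_projective_resolution
    (H : ∀ (R : Type u) [CommRing R] [IsNoetherianRing R] [IsReduced R],
      Scheme.IsQuasiExcellent (Spec (.of R)) → ringKrullDim R ≤ 3 →
        ∃ (X' : Scheme.{u}) (π : X' ⟶ Spec (.of R)), IsResolution π ∧
          ChowLemmaRing.IsProjOver (Over.mk π) ∧
            ∃ U : (Spec (.of R)).Opens,
              (U : Set (Spec (.of R))) = Scheme.regularLocus (Spec (.of R)) ∧ IsIso (π ∣_ U)) :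
    CossartPiltant2019AffineOneBlowup.{u} := by
  refine CossartPiltant2019AffineOneBlowup.of_forall_finiteType fun K _ A _ _ _ _ hdim => ?_
  haveI : IsNoetherianRing A := Algebra.FiniteType.isNoetherianRing K A
  let f : Spec (.of A) ⟶ Spec (.of K) := Spec.map (CommRingCat.ofHom (algebraMap K A))
  haveI : LocallyOfFiniteType f :=
    (HasRingHomProperty.Spec_iff (P := @LocallyOfFiniteType)).mpr
      (RingHom.finiteType_algebraMap.mpr inferInstance)
  have hqe : Scheme.IsQuasiExcellent (Spec (.of A)) :=
    Scheme.isQuasiExcellent_of_locallyOfFiniteType Stacks07QW_field_holds f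
  exact H A hqe hdim

end Literature.AlgebraicGeometry.Resolution

end
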